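import Summits.QuantumFields.YangMills.Theorems.BalabanUVNodesN08AtRecord13
import Summits.QuantumFields.YangMills.Theorems.BalabanUVNodesN08AlphaThreeFaces
import Literature.MathematicalPhysics.QuantumFieldTheory.Balaban1983to89.Node00.Record13LiveSelectorFamily

/-!
# BalabanUVNodes ∕ N08 AT A STAGE-13 RECORD WHOSE [B10] LAYER IS RE-BOUND TO AN EXHIBITED TOWER-RUN FAMILY — the socket through which dag-n08-d's
# (α) programme («cluster-expansion DATA schema ∧ three in-edge faces ⟹ Thm 1-compact ∧ Thm 2 for the lane's CONSTRUCTED d = 3 runs»,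
# `BalabanUVNodesN08AlphaThreeFaces`) meets the ₁₃C record of the route's K1‴ stub BY NAME (Track A, DAG node N08 [Balaban1985UV3] CMP **102** (1985) 255,
# Thm 1 p. 257 (compact reading) + Thm 2 p. 272; R134 fan-out seat `pub-ymgap-dag-n08-c` g7, strategy s2 «knit `B10Assembly` (`Thm1PrintedCompact ∧ Thm2Printed`) at the
# record of record by name», 2026-08-27)

WHY THIS FILE.  Every N08 storey of this lineage (₉CB10 … ₁₃, `N08AtStage5View`, `N08AtRecord13`, `N08AtRecord13Family`) presents the record at the [B10]-PINNED view
`θ.pinB10`: the B10 group of the residual carriers IS print's run family of record `Node00.runsB10OfRecord N θ.L` along print's averaging, and the `b10` leaf there IS the slot of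
record `Node00.PrintedUV3V N θ.L` — TYPED, NOT PROVED, the object gap of N08.  dag-n08-d's s1 (α) programme, on the other side, PROVES `DagDischarged.b10Compact` — [Balaban1985UV3]
Thm 1 (compact reading) ∧ Thm 2 — for carriers whose B10 group is the d = 3 lane's CONSTRUCTED tower-run family `S ↦ towerOf 𝔠.lane (X S) (𝔖 S)` on the N08 window
`ScalesLE L ((min γ_N08 1)²)`, from the cluster-expansion DATA schema at the concrete sizes and three in-edge faces (`b10Compact_constructedLE_of_faces₃_family`; in its g4 files the
faces are reduced, for minimiser-selected external inputs, to one displayed kinematic sentence (b11‴)), and reaches `Dag.B10_main` at worlds bound over those carriers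
(`b10_main_constructedLE_upC_of_faces₃_family`, `b10_main_at_record_of_faces₃Pin (Rec)`), but at no ₁₃C record.  def-T's record predicate `Node00.IsRecordOfRecord₁₃C F N D w`
presents its world over the Stage-13 view of SOME admissible parameter with provisos — the B10 layer of the residual carriers is NOT pinned by it — and dag-n10-d's carrier
stack (`Node00/Record13Carriers` §3, this seat's addendum A3) proves that EVERY admissible `θ` with provisos presents a ₁₃C record AT ITS OWN DATUM whose world is bound over ANY
re-bound view `θ.rebindX X'` (`Node00.exists_world_isRecordOfRecord₁₃C_rebindX`; guard, admissibility, datum, letters, histories all re-binding-blind).  HERE the two are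
knitted: re-binding the B10 layer of `θ`'s carriers to a tower-run family `T : I → B10.TowerRun` makes the `b10` leaf of the C-binding read EXACTLY
`B10.Thm1PrintedCompact (T·) ∧ B10.Thm2Printed (T·)` (§1, `Iff.rfl`; base-carrier-blind), so N08 holds at the re-bound ₁₃C record from that conjunction (§2), and at
`T :=` the lane's constructed family at block size `θ.L` from dag-n08-d's «DATA ∧ three faces» BY NAME (§3) — in the ∃-currency of K1‴'s `NodesAtSomeRecord13`, at any
admissible `θ` with provisos and guard, from K0‴'s antecedent text, and on K0a's all-numerics witness family `θ₁₃(n, ε₂₉)` from ROW P11 there (block size `F.L`).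

VACUITY GUARD (read this first).  `B10.Thm1Printed(Compact) ∕ Thm2Printed {I} (runs : I → RunData)` are ∀-statements over the index type: at an EMPTY family they hold
vacuously (§1 `b10Compact_withTowerRuns10_of_isEmpty`, kernel certificate).  Hence the `b10` leaf — and N08's conjunct of the ₁₃ nodes-∃ — at a record presented with an
UNPINNED or arbitrarily re-bound [B10] layer carries content ONLY through the EXHIBITED family: this is why the lineage files N08 at `pinB10` (print's family is nonempty for every
odd `L > 1`, `Node00.runsB10OfRecord_index_nonempty`) and why §2's generic theorems take the family `T` as displayed DATA; §3's family is the lane's on the N08 window, NONEMPTY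
for every odd `L > 1` (dag-n08-d `nonempty_scalesLE_gammaN08`), its `b10Compact` a THEOREM of the (α) programme under the displayed hypotheses — not a vacuity.  Whether the
K1‴ stub should READ `Nodes` at a pinned presentation (as dag-n24-c's four-pin assembler does) is the planner's call; this file asserts nothing about it.

WHAT THE RE-BOUND PRESENTATION IS NOT.  The [B10] layer of §3 is the lane's constructed family along GIVEN external inputs `X S : ExternalInputs S G` (the lane's
averaging class with its exact Haar compatibility field, [7]-minimiser selections `X.UkH`), NOT print's run family of record along `avOfPrint` — so §3 is NOT an inhabitant of
the slot of record `PrintedUV3V`, and whether N08's COUNT may be read at such a presentation is the chair's species word (seam E6′, R451 ∕ R454: (R-a) lane re-proof under `HaarAC`,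
(R-b) primed slot, (R-c) new mathematics); this file is count-neutral kernel bookkeeping that makes the «lane family at the ₁₃ record» option a by-name statement.
The group `(G, 𝔊)` of §3 is generic (`B10.TowerRun` is group-free data); the intended reading at the SU(2) record is `G := SU(2)` with the lane's `suGroupModel 2`.

WHAT THIS FILE PROVES (0 `def`, 0 `sorry`; kernel bookkeeping BY NAME).
* §1 faces: `b10Compact_withTowerRuns10_iff` (base-carrier-blind reading), `upOfRecord₅C_rebindX_withTowerRuns10_b10_iff` (the `b10` leaf of the C-binding at a Stage-5 view with
  re-bound B10 layer), `b10Compact_withTowerRuns10_of_isEmpty` (vacuity certificate).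
* §2 generic family `T`, hypothesis `hT : ∀ P, b10Compact ((Xc P).withTowerRuns10 T).toPrintedCarriers`: `b10_leaf_iff_∕b10_main_iff_∕b10_main_of_up_rebindX_towerRuns` (pointed, at a
  world bound over `(θ.rebindX (P ↦ (Xc P).withTowerRuns10 T)).toStage5₁₃`), `exists_world₁₃C_rebindX_towerRuns_b10_main` (a ₁₃C record of `datumOfRecord₁₃ θ h` so bound, any
  window, carrying N08 at every run), `exists_guarded_record₁₃C_b10_main_of_towerRuns` (N08's conjunct shape of `NodesAtSomeRecord13`, witnessed AT `θ`).
* §2b through the three outer pins: `upOfRecord₅C_rebindX_towerRuns_pin3_b10_iff` (the `b10` leaf over `(((σ.rebindX …).pinY Y₀).pinZ Z₀).pinW W₀`, every `Y₀ Z₀ W₀`),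
  `b10_main_of_up_rebindX_towerRuns_pin3` ∕ `b10_leaf_iff_of_up_rebindX_towerRuns_pin3` (the `h10leaf` line of a four-pin pointed assembler keyed to the lane family).
* §3 the lane instance at block size `θ.L`: `b10Compact_laneFamily_of_data_faces₃` (n08-d's theorem read at `θ`'s carriers), `exists_world₁₃C_laneFamily_b10_main_of_data_faces₃`,
  `exists_guarded_record₁₃C_laneFamily_b10_main_of_data_faces₃`, ★ `exists_guarded_record₁₃C_laneFamily_b10_main_of_inhabited13` («K0‴'s antecedent at `F` + lane objects with
  DATA ∧ faces at every odd block size `L > 1` ⟹ N08's conjunct of the ₁₃ nodes-∃», generic `N`, `_two` at `N = 2`), and ★★ on K0a's all-numerics witness family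
  `exists_guarded_record₁₃C_laneFamily_b10_main_of_bg_numerics_two` («`n.Pos`, `0 < ε₂₉`, ROW P11 at the member `θL F n ε₂₉` + lane objects with DATA ∧ faces AT BLOCK SIZE `F.L`
  ⟹ N08's conjunct», the lane twin of `N08AtRecord13Family`'s ★).
HONEST FRAMING.  Count-neutral; NOT A DISCHARGE OF N08; nothing of Bałaban's asserted — the cluster-expansion DATA schema (`RunDataRows` at `sizesOf`, classes II–III of dag-n08-b's
census = the object gap in data form), the three in-edge faces `InEdgeFaces₃` about the lane's free object `X.UkH`, K0‴'s rows (`Provisos₁₃` ∕ row P11 `hbg`), the guard and the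
signs are DISPLAYED hypotheses; the re-bound [B10] layer is NOT the slot of record (above); one finite four-torus per run at fixed `ε`, the lane's d = 3 tori inside the record;
nothing continuum ∕ ℝ⁴ ∕ OS ∕ mass gap ∕ Clay.  Filed `--supports` K1‴ `StabilityBAtRecordR13e` (stmt-QuantumFields-19910, route rev 16∕17) `--as helper`.
Sources: [Balaban1985UV3] Thm 1 p.257 (compact reading), Thm 2 p.272, (42) p.266, p.256 L15–18; [Balaban1989LargeFieldII] Thm 1 + (0.1) pp.355–356; [Balaban1988Convergent]
(2.28) p.259, (3.16)–(3.22) pp.268–269; [Balaban1985Variational] Thm 1 (8) p.279; [Balaban1987RG1] (0.1) p.251, (0.21) p.256, (2.9) p.266.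
-/

noncomputable section

namespace Summit.QuantumFields.YangMills.BalabanUVNodes.N08AtRecord13LaneFamily

open MeasureTheory
open scoped BigOperators Matrix.Norms.L2Operator
open Literature.MathematicalPhysics.QuantumFieldTheory.Balaban1983to89
open Literature.MathematicalPhysics.QuantumFieldTheory.Balaban1983to89.B10
open Literature.MathematicalPhysics.QuantumFieldTheory.Balaban1983to89.B10SectCExpansion (TermSizes)
open Literature.MathematicalPhysics.QuantumFieldTheory.Balaban1985CMP102
open Literature.MathematicalPhysics.QuantumFieldTheory.Balaban1985CMP102.Setting
open Literature.MathematicalPhysics.QuantumFieldTheory.Balaban1985CMP102.Theorems (Family runs)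
open Literature.MathematicalPhysics.QuantumFieldTheory.Balaban1983to89.T4Continuum (T4Family FiniteEpsData)
open Literature.MathematicalPhysics.QuantumFieldTheory.Balaban1983to89.DagBinding (leavesP WorldP PrintedCarriersR PrintedCarriers9X PrintedCarriers11 PrintedCarriers15)
open Literature.MathematicalPhysics.QuantumFieldTheory.Balaban1983to89.DagDischarged (b10Compact)
open Literature.MathematicalPhysics.QuantumFieldTheory.Balaban1983to89.Node00
open Summit.QuantumFields.Balaban3D.Carriers
open Summit.QuantumFields.Balaban3D.Proofs.Inputs
open Summit.QuantumFields.Balaban3D.Proofs.Primitives (AlphaConsts)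
open Summit.QuantumFields.Balaban3D.Proofs.GroupModelLieC (lieC)
open Summit.QuantumFields.Balaban3D.Proofs.UVStability3DInputs
open Summit.QuantumFields.Balaban3D.Proofs.FamilyLE (ScalesLE)
open Summit.QuantumFields.YangMills.Theorems.BalabanUVNodesN08AlphaClassI
open Summit.QuantumFields.YangMills.Theorems.BalabanUVNodesN08AlphaLoop28
open Summit.QuantumFields.YangMills.Theorems.BalabanUVNodesN08AlphaThreeFaces
open Summit.QuantumFields.YangMills.BalabanUVNodes.N08AtStage5View (b10_main_of_up_eq b10_leaf_iff_of_up_eq b10_main_iff_of_up_eq b10Face_pinY b10Face_pinZ b10Face_pinW)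
open Summit.QuantumFields.YangMills.BalabanUVNodes.N08AtRecord13

variable {F : T4Family} {N : ℕ} [NeZero N]

/-! ## §1 THE `b10` LEAF AT A RE-BOUND [B10] LAYER — faces and the vacuity certificate -/

section Faces

/-- **The compact node over carriers whose B10 group IS a tower-run family `T` reads [Balaban1985UV3] Thm 1 (compact) ∧ Thm 2 OF `T` — whatever the base carriers `X`**
(`Iff.rfl`: `b10Compact` reads the B10 group only). [cite: Balaban1985UV3, Thm 1 p.257 (compact reading) + Thm 2 p.272] -/
theorem b10Compact_withTowerRuns10_iff (X : PrintedCarriersR) {I : Type} (T : I → B10.TowerRun) :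
    b10Compact (X.withTowerRuns10 T).toPrintedCarriers ↔
      B10.Thm1PrintedCompact (fun i => (T i).toRunData) ∧ B10.Thm2Printed (fun i => (T i).toRunData) := Iff.rfl

/-- **The `b10` leaf of the C-binding of record at a Stage-5 view whose [B10] layer is RE-BOUND to `P ↦ (Xc P).withTowerRuns10 T` IS Thm 1 (compact) ∧ Thm 2 of `T`**
(`Iff.rfl`: node00-def g28's `upOfRecord₅C_b10_iff` — the Stage-3 substitutions `carriers₃` do not touch the B10 group). [cite: Balaban1985UV3, Thm 1 p.257 (compact reading) + Thm 2 p.272; Balaban1984PropagatorsII, pp.223–250 (the Stage-3 carriers; bookkeeping)] -/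
theorem upOfRecord₅C_rebindX_withTowerRuns10_b10_iff (σ : Stage5Params F N) (Xc : B12.RunParams → PrintedCarriersR) {I : Type} (T : I → B10.TowerRun)
    (P : B12.RunParams) :
    (upOfRecord₅C F N (σ.rebindX F N fun P => (Xc P).withTowerRuns10 T) P).b10 ↔
      B10.Thm1PrintedCompact (fun i => (T i).toRunData) ∧ B10.Thm2Printed (fun i => (T i).toRunData) := Iff.rfl

/-- … equivalently, it IS `b10Compact ((Xc P).withTowerRuns10 T)` (the form dag-n08-d's closers conclude; `Iff.rfl`). [cite: Balaban1985UV3, Thm 1 p.257 (compact reading) + Thm 2 p.272] -/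
theorem upOfRecord₅C_rebindX_withTowerRuns10_b10_iff_b10Compact (σ : Stage5Params F N) (Xc : B12.RunParams → PrintedCarriersR) {I : Type} (T : I → B10.TowerRun)
    (P : B12.RunParams) :
    (upOfRecord₅C F N (σ.rebindX F N fun P => (Xc P).withTowerRuns10 T) P).b10 ↔ b10Compact ((Xc P).withTowerRuns10 T).toPrintedCarriers := Iff.rfl

/-- **VACUITY CERTIFICATE**: at an EMPTY tower-run family the compact node holds outright — so a re-bound [B10] layer carries content only through the EXHIBITED family
(the reason this lineage presents N08 at `pinB10`, print's nonempty run family of record, or — §3 — at the lane's nonempty constructed family). [cite: Balaban1985UV3, Thm 1 p.257, Thm 2 p.272 (the printed statements are ∀ over the lattice approximations; bookkeeping)] -/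
theorem b10Compact_withTowerRuns10_of_isEmpty (X : PrintedCarriersR) {I : Type} [IsEmpty I] (T : I → B10.TowerRun) :
    b10Compact (X.withTowerRuns10 T).toPrintedCarriers :=
  (b10Compact_withTowerRuns10_iff X T).2 ⟨fun _ _ _ _ => ⟨0, fun i => isEmptyElim i⟩, fun i => isEmptyElim i⟩

end Faces

/-! ## §2 N08 AT A ₁₃C RECORD WHOSE [B10] LAYER IS RE-BOUND TO A TOWER-RUN FAMILY `T` CARRYING Thm 1-compact ∧ Thm 2 (generic `T`, displayed as DATA) -/

section Generic
variable (θ : Stage13Params F N) (Xc : B12.RunParams → PrintedCarriersR) {I : Type} (T : I → B10.TowerRun) {w : WorldP}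

/-- **EXACT LEAF at a world bound over the re-bound Stage-13 view**: `b10 ⟺ b10Compact ((Xc P).withTowerRuns10 T)`. [cite: Balaban1985UV3, Thm 1 p.257 (compact reading) + Thm 2 p.272] -/
theorem b10_leaf_iff_of_up_rebindX_towerRuns
    (hup : ∀ P, w.up P = upOfRecord₅C F N ((θ.rebindX F N fun P => (Xc P).withTowerRuns10 T).toStage5₁₃ F N) P) (P : B12.RunParams) :
    (leavesP w P).b10 ↔ b10Compact ((Xc P).withTowerRuns10 T).toPrintedCarriers :=
  b10_leaf_iff_of_up_eq (hup P) (upOfRecord₅C_rebindX_withTowerRuns10_b10_iff_b10Compact _ Xc T P)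

/-- **EXACT READING OF N08 there**: `Dag.B10_main ⟺ (in-edge leaves ⟹ b10Compact ((Xc P).withTowerRuns10 T))`. [cite: Balaban1985UV3, Thm 1 p.257 (compact reading) + Thm 2 p.272] -/
theorem b10_main_iff_of_up_rebindX_towerRuns
    (hup : ∀ P, w.up P = upOfRecord₅C F N ((θ.rebindX F N fun P => (Xc P).withTowerRuns10 T).toStage5₁₃ F N) P) (P : B12.RunParams) :
    Dag.B10_main (leavesP w P) ↔
      ((leavesP w P).b5 → (leavesP w P).b6 → (leavesP w P).b7 → (leavesP w P).b8 → (leavesP w P).b9 → (leavesP w P).b11 →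
        b10Compact ((Xc P).withTowerRuns10 T).toPrintedCarriers) :=
  b10_main_iff_of_up_eq (hup P) (upOfRecord₅C_rebindX_withTowerRuns10_b10_iff_b10Compact _ Xc T P)

/-- **POINTED CLOSER**: at a world bound over the re-bound Stage-13 view, N08 at every run ⟸ the compact node of the re-bound carriers at every run (in-edges unused;
this seat's generic `N08AtStage5View.b10_main_of_up_eq`). [cite: Balaban1985UV3, Thm 1 p.257 (compact reading) + Thm 2 p.272] -/
theorem b10_main_of_up_rebindX_towerRuns
    (hup : ∀ P, w.up P = upOfRecord₅C F N ((θ.rebindX F N fun P => (Xc P).withTowerRuns10 T).toStage5₁₃ F N) P)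
    (hT : ∀ P : B12.RunParams, b10Compact ((Xc P).withTowerRuns10 T).toPrintedCarriers) (P : B12.RunParams) :
    Dag.B10_main (leavesP w P) :=
  b10_main_of_up_eq (hup P) (upOfRecord₅C_rebindX_withTowerRuns10_b10_iff_b10Compact _ Xc T P) (hT P)

variable {θ}

/-- **∃-CURRENCY**: at the datum of ANY admissible Stage-13 tuple with provisos, a world (any window `γw`, block size `θ.L`) that IS a ₁₃C record of `datumOfRecord₁₃ F N θ h`,
bound over the Stage-13 view with the [B10] layer re-bound to `P ↦ (Xc P).withTowerRuns10 T`, carrying N08 at every run — from the compact node of those carriers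
(dag-n10-d's `exists_world_isRecordOfRecord₁₃C_rebindX` + the pointed closer). [cite: Balaban1985UV3, Thm 1 p.257 (compact reading) + Thm 2 p.272; Balaban1989LargeFieldII, Thm 1 + (0.1) pp.355–356 (the record's world; bookkeeping)] -/
theorem exists_world₁₃C_rebindX_towerRuns_b10_main (h : θ.Provisos₁₃ F N) (hθ : θ.Admissible F N) {γw : ℝ} (hγw : 0 < γw ∧ γw ≤ θ.γ)
    (hT : ∀ P : B12.RunParams, b10Compact ((Xc P).withTowerRuns10 T).toPrintedCarriers) :
    ∃ w : WorldP, IsRecordOfRecord₁₃C F N (datumOfRecord₁₃ F N θ h) w ∧ w.γ = γw ∧ w.L = (θ.L : ℝ) ∧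
      (∀ P, w.up P = upOfRecord₅C F N ((θ.rebindX F N fun P => (Xc P).withTowerRuns10 T).toStage5₁₃ F N) P) ∧
      ∀ P : B12.RunParams, Dag.B10_main (leavesP w P) := by
  obtain ⟨w, hR, hγ, hL, hup⟩ := exists_world_isRecordOfRecord₁₃C_rebindX F N θ h hθ (fun P => (Xc P).withTowerRuns10 T) hγw
  exact ⟨w, hR, hγ, hL, hup, b10_main_of_up_rebindX_towerRuns θ Xc T hup hT⟩

/-- **N08's CONJUNCT SHAPE OF K1‴'s `NodesAtSomeRecord13`, WITNESSED AT `θ` ITSELF** (guard and admissibility read at `θ`; the presenting re-bound parameter is inside the ∃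
of `IsRecordOfRecord₁₃C`): from provisos, admissibility, the guard, and the compact node of the re-bound carriers at every run. [cite: Balaban1985UV3, Thm 1 p.257 (compact reading) + Thm 2 p.272; Balaban1989LargeFieldII, Thm 1 + (0.1) pp.355–356; Balaban1988Convergent, (3.16)–(3.22) pp.268–269 (the guard; bookkeeping)] -/
theorem exists_guarded_record₁₃C_b10_main_of_towerRuns (h : θ.Provisos₁₃ F N) (hθ : θ.Admissible F N) (hG : θ.ZtUnity F N ∧ θ.SlotsNondegenerate₁₃ F N)
    (hT : ∀ P : B12.RunParams, b10Compact ((Xc P).withTowerRuns10 T).toPrintedCarriers) :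
    ∃ (θ' : Stage13Params F N) (h' : θ'.Provisos₁₃ F N) (w : WorldP), (θ'.ZtUnity F N ∧ θ'.SlotsNondegenerate₁₃ F N) ∧ θ'.Admissible F N ∧
      IsRecordOfRecord₁₃C F N (datumOfRecord₁₃ F N θ' h') w ∧ ∀ P : B12.RunParams, Dag.B10_main (leavesP w P) := by
  obtain ⟨w, hR, -, -, -, hN⟩ := exists_world₁₃C_rebindX_towerRuns_b10_main Xc T h hθ ⟨hθ.toStage9.gamma_pos, le_rfl⟩ hT
  exact ⟨θ, h, w, hG, hθ, hR, hN⟩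

end Generic

/-! ## §2b THE SAME LEAF THROUGH THE THREE OUTER PINS — over `(((σ.rebindX …).pinY Y₀).pinZ Z₀).pinW W₀` (the word a four-pin pointed Stage-13 assembler binds over, with the
lane family in the [B10] slot instead of print's; this seat's `N08AtStage5View.b10Face_pinY ∕ _pinZ ∕ _pinW` BY NAME) -/

section Pin3
variable (Xc : B12.RunParams → PrintedCarriersR) {I : Type} (T : I → B10.TowerRun) (Y₀ : PrintedCarriers9X) (Z₀ : PrintedCarriers11)
  (W₀ : B12.RunParams → PrintedCarriers15)

/-- **The `b10` leaf over the lane-keyed four-layer word** `(((σ.rebindX (P ↦ (Xc P).withTowerRuns10 T)).pinY Y₀).pinZ Z₀).pinW W₀` IS `b10Compact ((Xc P).withTowerRuns10 T)`,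
for EVERY `Y₀ Z₀ W₀` (the Y ∕ Z ∕ W pins touch `b9` ∕ `b11` ∕ `rBasicStep` only). [cite: Balaban1985UV3, Thm 1 p.257 (compact reading) + Thm 2 p.272; Balaban1985BackgroundPropagators, Thm 3.1 p.397; Balaban1985Variational, Thm 1 p.279; Balaban1989LargeFieldI, (0.2) p.176 (bookkeeping: the outer pins)] -/
theorem upOfRecord₅C_rebindX_towerRuns_pin3_b10_iff (σ : Stage5Params F N) (P : B12.RunParams) :
    (upOfRecord₅C F N ((((σ.rebindX F N fun P => (Xc P).withTowerRuns10 T).pinY F N Y₀).pinZ F N Z₀).pinW F N W₀) P).b10 ↔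
      b10Compact ((Xc P).withTowerRuns10 T).toPrintedCarriers :=
  b10Face_pinW _ W₀ (b10Face_pinZ _ Z₀ (b10Face_pinY _ Y₀ (upOfRecord₅C_rebindX_withTowerRuns10_b10_iff_b10Compact σ Xc T P)))

/-- **POINTED CLOSER over the lane-keyed four-layer Stage-13 word** `((((θ.rebindX …).pinY Y₀).pinZ Z₀).pinW W₀).toStage5₁₃` (= the Stage-5 word at `σ := θ.toStage5₁₃`,
dag-n10-d's `toStage5₁₃_rebindX ∕ _pinY ∕ _pinZ ∕ _pinW`, `rfl`): N08 at every run ⟸ the compact node of the re-bound carriers at every run — the `h10leaf` line of a four-pin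
pointed assembler that takes N08 from the (α) programme. [cite: Balaban1985UV3, Thm 1 p.257 (compact reading) + Thm 2 p.272] -/
theorem b10_main_of_up_rebindX_towerRuns_pin3 (θ : Stage13Params F N) {w : WorldP}
    (hup : ∀ P, w.up P = upOfRecord₅C F N
      (((((θ.rebindX F N fun P => (Xc P).withTowerRuns10 T).pinY F N Y₀).pinZ F N Z₀).pinW F N W₀).toStage5₁₃ F N) P)
    (hT : ∀ P : B12.RunParams, b10Compact ((Xc P).withTowerRuns10 T).toPrintedCarriers) (P : B12.RunParams) :
    Dag.B10_main (leavesP w P) :=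
  b10_main_of_up_eq ((hup P).trans (by
      rw [Stage13Params.toStage5₁₃_pinW, Stage13Params.toStage5₁₃_pinZ, Stage13Params.toStage5₁₃_pinY, Stage13Params.toStage5₁₃_rebindX]))
    (upOfRecord₅C_rebindX_towerRuns_pin3_b10_iff Xc T Y₀ Z₀ W₀ (θ.toStage5₁₃ F N) P) (hT P)

/-- … and the exact leaf there. [cite: Balaban1985UV3, Thm 1 p.257 (compact reading) + Thm 2 p.272] -/
theorem b10_leaf_iff_of_up_rebindX_towerRuns_pin3 (θ : Stage13Params F N) {w : WorldP}
    (hup : ∀ P, w.up P = upOfRecord₅C F N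
      (((((θ.rebindX F N fun P => (Xc P).withTowerRuns10 T).pinY F N Y₀).pinZ F N Z₀).pinW F N W₀).toStage5₁₃ F N) P) (P : B12.RunParams) :
    (leavesP w P).b10 ↔ b10Compact ((Xc P).withTowerRuns10 T).toPrintedCarriers :=
  b10_leaf_iff_of_up_eq ((hup P).trans (by
      rw [Stage13Params.toStage5₁₃_pinW, Stage13Params.toStage5₁₃_pinZ, Stage13Params.toStage5₁₃_pinY, Stage13Params.toStage5₁₃_rebindX]))
    (upOfRecord₅C_rebindX_towerRuns_pin3_b10_iff Xc T Y₀ Z₀ W₀ (θ.toStage5₁₃ F N) P)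

end Pin3

/-! ## §3 THE LANE INSTANCE: dag-n08-d's CONSTRUCTED FAMILY `S ↦ towerOf 𝔠.lane (X S) (𝔖 S)` ON THE N08 WINDOW `ScalesLE θ.L ((min γ_N08 1)²)` AT THE RECORD'S BLOCK SIZE,
from «cluster-expansion DATA schema ∧ three in-edge faces» BY NAME (`b10Compact_constructedLE_of_faces₃_family`) -/

section Lane
variable {G : Type} [GaugeGroup G] [MeasurableSpace G] [HaarData G] {𝔊 : GroupModel G}

/-- **The compact node for `θ`'s carriers with the [B10] layer re-bound to the lane's constructed family at block size `θ.L`, from «DATA ∧ three faces»** (dag-n08-d g3's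
`b10Compact_constructedLE_of_faces₃_family` read at the base carriers `θ.res.X P`, every run `P`).  Hypotheses DISPLAYED: the DATA schema `RunDataRows` at the concrete sizes and
the three in-edge faces `InEdgeFaces₃` at print's single regularity constant, on the N08 family `g²ε₀ ≤ (min γ_N08 1)²`. [cite: Balaban1985UV3, Thm 1 p.257 (compact reading) + Thm 2 p.272 + p.256 L15–18] -/
theorem b10Compact_laneFamily_of_data_faces₃ (θ : Stage13Params F N) {𝔠 : AlphaConsts θ.L 𝔊.N} {X : ∀ S : Scales θ.L, ExternalInputs S G}
    {𝔖 : ∀ (S : Scales θ.L) (k : ℕ), StepSeries S G ↥(lieC 𝔊) (nblkOf S 𝔠.lane.carrier k) k} {𝔄 : ∀ S : Scales θ.L, AlphaData 𝔊 𝔠 (X S) (𝔖 S)}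
    (coef : ∀ (S : Scales θ.L) (k : ℕ), Hist S.P (k + 1) → GaugeField S.P (k + 1) G → (j : ℕ) → TermSizes (oldGeom S.P k j))
    (hD : ∀ S : Scales θ.L, S.g ^ 2 * S.ε₀ ≤ (min (gammaN08 𝔠) 1) ^ 2 → RunDataRows 𝔊 𝔠 (X S) (𝔖 S) (𝔄 S) (sizesOf 𝔊 𝔠 (X S) (coef S)))
    (hF : ∀ S : Scales θ.L, S.g ^ 2 * S.ε₀ ≤ (min (gammaN08 𝔠) 1) ^ 2 → InEdgeFaces₃ 𝔊 (regMin 𝔠) (X S)) (P : B12.RunParams) :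
    b10Compact ((θ.res.X P).withTowerRuns10 fun S : ScalesLE θ.L ((min (gammaN08 𝔠) 1) ^ 2) => towerOf 𝔠.lane (X S.1) (𝔖 S.1)).toPrintedCarriers :=
  b10Compact_constructedLE_of_faces₃_family (coef := coef) hD hF (θ.res.X P)

omit [HaarData G] in
/-- **THE LANE FAMILY IS NONEMPTY at every Stage-13 parameter's block size** (`θ.L` is odd and `> 1`; dag-n08-d's `nonempty_scalesLE_gammaN08`) — §1's vacuity does not apply
to §3. [cite: Balaban1985UV3, p.256 L15–18 (the family of lattice approximations; bookkeeping)] -/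
theorem nonempty_laneIndex (θ : Stage13Params F N) (𝔠 : AlphaConsts θ.L 𝔊.N) : Nonempty (ScalesLE θ.L ((min (gammaN08 𝔠) 1) ^ 2)) :=
  (nonempty_scalesLE_gammaN08 𝔠 θ.hL).1

/-- **A ₁₃C RECORD OF `datumOfRecord₁₃ F N θ h` BOUND OVER THE LANE-RE-BOUND STAGE-13 VIEW, CARRYING N08 AT EVERY RUN, from «DATA ∧ three faces»** (any window `γw`, block
size `θ.L`).  The world at which a pointed Stage-13 assembler wanting N08 from the (α) programme — rather than from the slot of record — presents the other nodes.
[cite: Balaban1985UV3, Thm 1 p.257 (compact reading) + Thm 2 p.272; Balaban1989LargeFieldII, Thm 1 + (0.1) pp.355–356 (bookkeeping)] -/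
theorem exists_world₁₃C_laneFamily_b10_main_of_data_faces₃ (θ : Stage13Params F N) (h : θ.Provisos₁₃ F N) (hθ : θ.Admissible F N)
    {𝔠 : AlphaConsts θ.L 𝔊.N} {X : ∀ S : Scales θ.L, ExternalInputs S G}
    {𝔖 : ∀ (S : Scales θ.L) (k : ℕ), StepSeries S G ↥(lieC 𝔊) (nblkOf S 𝔠.lane.carrier k) k} {𝔄 : ∀ S : Scales θ.L, AlphaData 𝔊 𝔠 (X S) (𝔖 S)}
    (coef : ∀ (S : Scales θ.L) (k : ℕ), Hist S.P (k + 1) → GaugeField S.P (k + 1) G → (j : ℕ) → TermSizes (oldGeom S.P k j))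
    (hD : ∀ S : Scales θ.L, S.g ^ 2 * S.ε₀ ≤ (min (gammaN08 𝔠) 1) ^ 2 → RunDataRows 𝔊 𝔠 (X S) (𝔖 S) (𝔄 S) (sizesOf 𝔊 𝔠 (X S) (coef S)))
    (hF : ∀ S : Scales θ.L, S.g ^ 2 * S.ε₀ ≤ (min (gammaN08 𝔠) 1) ^ 2 → InEdgeFaces₃ 𝔊 (regMin 𝔠) (X S))
    {γw : ℝ} (hγw : 0 < γw ∧ γw ≤ θ.γ) :
    ∃ w : WorldP, IsRecordOfRecord₁₃C F N (datumOfRecord₁₃ F N θ h) w ∧ w.γ = γw ∧ w.L = (θ.L : ℝ) ∧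
      (∀ P, w.up P = upOfRecord₅C F N ((θ.rebindX F N fun P => (θ.res.X P).withTowerRuns10
        fun S : ScalesLE θ.L ((min (gammaN08 𝔠) 1) ^ 2) => towerOf 𝔠.lane (X S.1) (𝔖 S.1)).toStage5₁₃ F N) P) ∧
      ∀ P : B12.RunParams, Dag.B10_main (leavesP w P) :=
  exists_world₁₃C_rebindX_towerRuns_b10_main _ _ h hθ hγw (b10Compact_laneFamily_of_data_faces₃ θ coef hD hF)

/-- **N08's CONJUNCT SHAPE OF `NodesAtSomeRecord13`, WITNESSED AT `θ`, from «DATA ∧ three faces» at block size `θ.L`** (plus `θ`'s provisos, admissibility and guard).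
[cite: Balaban1985UV3, Thm 1 p.257 (compact reading) + Thm 2 p.272; Balaban1989LargeFieldII, Thm 1 + (0.1) pp.355–356; Balaban1988Convergent, (3.16)–(3.22) pp.268–269 (bookkeeping)] -/
theorem exists_guarded_record₁₃C_laneFamily_b10_main_of_data_faces₃ (θ : Stage13Params F N) (h : θ.Provisos₁₃ F N) (hθ : θ.Admissible F N)
    (hG : θ.ZtUnity F N ∧ θ.SlotsNondegenerate₁₃ F N) {𝔠 : AlphaConsts θ.L 𝔊.N} {X : ∀ S : Scales θ.L, ExternalInputs S G}
    {𝔖 : ∀ (S : Scales θ.L) (k : ℕ), StepSeries S G ↥(lieC 𝔊) (nblkOf S 𝔠.lane.carrier k) k} {𝔄 : ∀ S : Scales θ.L, AlphaData 𝔊 𝔠 (X S) (𝔖 S)}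
    (coef : ∀ (S : Scales θ.L) (k : ℕ), Hist S.P (k + 1) → GaugeField S.P (k + 1) G → (j : ℕ) → TermSizes (oldGeom S.P k j))
    (hD : ∀ S : Scales θ.L, S.g ^ 2 * S.ε₀ ≤ (min (gammaN08 𝔠) 1) ^ 2 → RunDataRows 𝔊 𝔠 (X S) (𝔖 S) (𝔄 S) (sizesOf 𝔊 𝔠 (X S) (coef S)))
    (hF : ∀ S : Scales θ.L, S.g ^ 2 * S.ε₀ ≤ (min (gammaN08 𝔠) 1) ^ 2 → InEdgeFaces₃ 𝔊 (regMin 𝔠) (X S)) :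
    ∃ (θ' : Stage13Params F N) (h' : θ'.Provisos₁₃ F N) (w : WorldP), (θ'.ZtUnity F N ∧ θ'.SlotsNondegenerate₁₃ F N) ∧ θ'.Admissible F N ∧
      IsRecordOfRecord₁₃C F N (datumOfRecord₁₃ F N θ' h') w ∧ ∀ P : B12.RunParams, Dag.B10_main (leavesP w P) :=
  exists_guarded_record₁₃C_b10_main_of_towerRuns _ _ h hθ hG (b10Compact_laneFamily_of_data_faces₃ θ coef hD hF)

/-- **★ «K0‴'s ANTECEDENT ⟹ N08's CONJUNCT OF THE STAGE-13 NODES-∃» THROUGH THE LANE, generic `N`**: from `∃ θ, Provisos₁₃ ∧ (ZtUnity ∧ SlotsNondegenerate₁₃) ∧ Admissible`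
at `F` (HYPOTHESIS `hI`) and, AT EVERY ODD BLOCK SIZE `L > 1`, lane objects `(𝔠, X, 𝔖, 𝔄, coef)` carrying the DATA schema and the three in-edge faces on the N08 window
(HYPOTHESIS `hlane` — the (α) programme's displayed inputs, in place of the slot socket `∀ L, Odd L → 1 < L → PrintedUV3V N L` of `N08AtRecord13` §2).  NOT the stub, NOT a
discharge; the [B10] layer is the lane's, not print's (module docstring). [cite: Balaban1985UV3, Thm 1 p.257 (compact reading) + Thm 2 p.272 + p.256 L15–18; Balaban1989LargeFieldII, Thm 1 + (0.1) pp.355–356 (bookkeeping)] -/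
theorem exists_guarded_record₁₃C_laneFamily_b10_main_of_inhabited13
    (hI : ∃ θ : Stage13Params F N, θ.Provisos₁₃ F N ∧ (θ.ZtUnity F N ∧ θ.SlotsNondegenerate₁₃ F N) ∧ θ.Admissible F N)
    (hlane : ∀ L : ℕ, Odd L → 1 < L →
      ∃ (𝔠 : AlphaConsts L 𝔊.N) (X : ∀ S : Scales L, ExternalInputs S G)
        (𝔖 : ∀ (S : Scales L) (k : ℕ), StepSeries S G ↥(lieC 𝔊) (nblkOf S 𝔠.lane.carrier k) k) (𝔄 : ∀ S : Scales L, AlphaData 𝔊 𝔠 (X S) (𝔖 S))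
        (coef : ∀ (S : Scales L) (k : ℕ), Hist S.P (k + 1) → GaugeField S.P (k + 1) G → (j : ℕ) → TermSizes (oldGeom S.P k j)),
        (∀ S : Scales L, S.g ^ 2 * S.ε₀ ≤ (min (gammaN08 𝔠) 1) ^ 2 → RunDataRows 𝔊 𝔠 (X S) (𝔖 S) (𝔄 S) (sizesOf 𝔊 𝔠 (X S) (coef S))) ∧
        (∀ S : Scales L, S.g ^ 2 * S.ε₀ ≤ (min (gammaN08 𝔠) 1) ^ 2 → InEdgeFaces₃ 𝔊 (regMin 𝔠) (X S))) :
    ∃ (θ : Stage13Params F N) (h : θ.Provisos₁₃ F N) (w : WorldP), (θ.ZtUnity F N ∧ θ.SlotsNondegenerate₁₃ F N) ∧ θ.Admissible F N ∧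
      IsRecordOfRecord₁₃C F N (datumOfRecord₁₃ F N θ h) w ∧ ∀ P : B12.RunParams, Dag.B10_main (leavesP w P) := by
  obtain ⟨θ, h, hG, hθ⟩ := hI
  obtain ⟨𝔠, X, 𝔖, 𝔄, coef, hD, hF⟩ := hlane θ.L θ.hL.1 θ.hL.2
  exact exists_guarded_record₁₃C_laneFamily_b10_main_of_data_faces₃ θ h hθ hG (𝔄 := 𝔄) coef hD hF

/-- **★ THE SAME AT THE GROUP OF RECORD `N = 2`, hypothesis `hI` = the rev-16 K0‴ text VERBATIM.**  Intended lane group: `G := SU(2)`. [cite: Balaban1985UV3, Thm 1 p.257 (compact reading) + Thm 2 p.272; Balaban1989LargeFieldII, Thm 1 + (0.1) pp.355–356 (bookkeeping)] -/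
theorem exists_guarded_record₁₃C_laneFamily_b10_main_of_inhabited13_two (F : T4Family)
    (hI : ∃ θ : Stage13Params F 2, θ.Provisos₁₃ F 2 ∧ (θ.ZtUnity F 2 ∧ θ.SlotsNondegenerate₁₃ F 2) ∧ θ.Admissible F 2)
    (hlane : ∀ L : ℕ, Odd L → 1 < L →
      ∃ (𝔠 : AlphaConsts L 𝔊.N) (X : ∀ S : Scales L, ExternalInputs S G)
        (𝔖 : ∀ (S : Scales L) (k : ℕ), StepSeries S G ↥(lieC 𝔊) (nblkOf S 𝔠.lane.carrier k) k) (𝔄 : ∀ S : Scales L, AlphaData 𝔊 𝔠 (X S) (𝔖 S))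
        (coef : ∀ (S : Scales L) (k : ℕ), Hist S.P (k + 1) → GaugeField S.P (k + 1) G → (j : ℕ) → TermSizes (oldGeom S.P k j)),
        (∀ S : Scales L, S.g ^ 2 * S.ε₀ ≤ (min (gammaN08 𝔠) 1) ^ 2 → RunDataRows 𝔊 𝔠 (X S) (𝔖 S) (𝔄 S) (sizesOf 𝔊 𝔠 (X S) (coef S))) ∧
        (∀ S : Scales L, S.g ^ 2 * S.ε₀ ≤ (min (gammaN08 𝔠) 1) ^ 2 → InEdgeFaces₃ 𝔊 (regMin 𝔠) (X S))) :
    ∃ (θ : Stage13Params F 2) (h : θ.Provisos₁₃ F 2) (w : WorldP), (θ.ZtUnity F 2 ∧ θ.SlotsNondegenerate₁₃ F 2) ∧ θ.Admissible F 2 ∧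
      IsRecordOfRecord₁₃C F 2 (datumOfRecord₁₃ F 2 θ h) w ∧ ∀ P : B12.RunParams, Dag.B10_main (leavesP w P) :=
  exists_guarded_record₁₃C_laneFamily_b10_main_of_inhabited13 hI hlane

/-- **★★ ON K0a's ALL-NUMERICS WITNESS FAMILY `θL F n ε₂₉ = theta13LiveOfNumerics F 2 n ε₂₉ …` (block size KNOWN: `F.L`), `N = 2`: from `n.Pos`, `0 < ε₂₉`, ROW P11 at the
member (K0a's socket text verbatim) AND lane objects at block size `F.L` with «DATA ∧ three faces» ⟹ N08's conjunct of the ₁₃ nodes-∃** — the lane twin of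
`N08AtRecord13Family.exists_guarded_record₁₃C_b10_main_of_bg_numerics_two` (there: `PrintedUV3V 2 F.L`; here: the (α) programme's inputs at `F.L`).  NOT a discharge; the
[B10] layer is the lane's. [cite: Balaban1985UV3, Thm 1 p.257 (compact reading) + Thm 2 p.272; Balaban1988Convergent, (2.28) p.259, (3.16)–(3.22) pp.268–269; Balaban1989LargeFieldI, (0.3)–(0.4) p.176 (bookkeeping)] -/
theorem exists_guarded_record₁₃C_laneFamily_b10_main_of_bg_numerics_two (F : T4Family) {n : Stage12Numerics} {ε₂₉ : ℝ} (hn : n.Pos) (hε' : 0 < ε₂₉)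
    (hbg : ∀ (p : B12.RunParams) (m : ℕ), m ≤ p.K →
      Step.InInterval (theta13OfNumerics F 2 n ε₂₉ (zeta316OfRecord F 2 n.ν n.τ9.M n.A₁) (RzOfRecord F 2) (ZtOfRecord F 2)).γ m
        (gOfRecord₁₃ F 2 (theta13OfNumerics F 2 n ε₂₉ (zeta316OfRecord F 2 n.ν n.τ9.M n.A₁) (RzOfRecord F 2) (ZtOfRecord F 2)) p) →
      BgProvisoΛ F 2 p.K
        (settingOfRecord₁₃ F 2 (theta13LiveOfNumerics F 2 n ε₂₉ (zeta316OfRecord F 2 n.ν n.τ9.M n.A₁) (RzOfRecord F 2) (ZtOfRecord F 2)) p)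
        (RzOfRecord F 2 p.K) n.τ9.M m
        (suppOfRecord₁₃ F 2 (theta13LiveOfNumerics F 2 n ε₂₉ (zeta316OfRecord F 2 n.ν n.τ9.M n.A₁) (RzOfRecord F 2) (ZtOfRecord F 2)) p m)
        (UbgOfRecord₁₃ F 2 (theta13LiveOfNumerics F 2 n ε₂₉ (zeta316OfRecord F 2 n.ν n.τ9.M n.A₁) (RzOfRecord F 2) (ZtOfRecord F 2)) p m))
    {𝔠 : AlphaConsts F.L 𝔊.N} {X : ∀ S : Scales F.L, ExternalInputs S G}
    {𝔖 : ∀ (S : Scales F.L) (k : ℕ), StepSeries S G ↥(lieC 𝔊) (nblkOf S 𝔠.lane.carrier k) k} {𝔄 : ∀ S : Scales F.L, AlphaData 𝔊 𝔠 (X S) (𝔖 S)}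
    (coef : ∀ (S : Scales F.L) (k : ℕ), Hist S.P (k + 1) → GaugeField S.P (k + 1) G → (j : ℕ) → TermSizes (oldGeom S.P k j))
    (hD : ∀ S : Scales F.L, S.g ^ 2 * S.ε₀ ≤ (min (gammaN08 𝔠) 1) ^ 2 → RunDataRows 𝔊 𝔠 (X S) (𝔖 S) (𝔄 S) (sizesOf 𝔊 𝔠 (X S) (coef S)))
    (hF : ∀ S : Scales F.L, S.g ^ 2 * S.ε₀ ≤ (min (gammaN08 𝔠) 1) ^ 2 → InEdgeFaces₃ 𝔊 (regMin 𝔠) (X S)) :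
    ∃ (θ : Stage13Params F 2) (h : θ.Provisos₁₃ F 2) (w : WorldP), (θ.ZtUnity F 2 ∧ θ.SlotsNondegenerate₁₃ F 2) ∧ θ.Admissible F 2 ∧
      IsRecordOfRecord₁₃C F 2 (datumOfRecord₁₃ F 2 θ h) w ∧ ∀ P : B12.RunParams, Dag.B10_main (leavesP w P) :=
  have hP := provisos₁₃_theta13LiveOfNumerics_of_bg F 2 n ε₂₉ hbg
  exists_guarded_record₁₃C_laneFamily_b10_main_of_data_faces₃ _ hP (admissible_theta13LiveOfNumerics F 2 _ _ _ hn hε')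
    ⟨ztUnity_theta13LiveOfNumerics F 2 n ε₂₉, slotsNondegenerate₁₃_theta13LiveOfNumerics F 2 n ε₂₉ _ _ _ hP⟩ (𝔄 := 𝔄) coef hD hF

end Lane

end Summit.QuantumFields.YangMills.BalabanUVNodes.N08AtRecord13LaneFamily

end
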